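import Mathlib
import Summits.NavierStokesRegularity.NavierStokesRegularity.Theorems.ThreadingFluxHorizonTowerZonalAssembly
import Summits.NavierStokesRegularity.NavierStokesRegularity.Theorems.ThreadingFluxLoopLawSameDegreeBracketRigidity
import Summits.NavierStokesRegularity.NavierStokesRegularity.Theorems.ThreadingFluxCentreJetDefs
import HarnessLib

/-!
# Crux `PoloidalLiouville` (stmt-NavierStokesRegularity-1222, W1/W2), crux idea «reynolds-quadrupole-threading» (ns-idea-15):
# HARMONIC BRACKET RIGIDITY — `HarmonicBracketRigidity` of `Cruxes/PoloidalLiouville/ReynoldsQuadrupoleSketch.lean` (l.227), the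
# «ALGEBRAIC LEMMA of the general-degree programme», FROM the Euler-top lemmas A1/A2 of the «steady-centre-sieve» card

Support file (`--supports stmt-NavierStokesRegularity-1222`, helper).  Experiment cell `ns-wall-extremal`, width hand ns-wall-eng-3 g3
(W1 adjunct; 0 kit).  Statement = the sketch's `HarmonicBracketRigidity` body VERBATIM with the sketch-local `IsShapeTensor` replaced by
the character-identical Theorems-side `HorizonTower.IsShapeTensor` (ns-wall-eng-4 g3's K-alg₂ precedent p681178): **a degree-`l ≥ 1`
harmonic polynomial `H` on `ℝ³` that Poisson-commutes on spheres with a traceless symmetric quadratic form `M` (`det(y, ∇H(y), My) ≡ 0`)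
has `M = 0`, or `H = β·⟪y, My⟫`, or `M` uniaxial with axis `a` and `H` axisymmetric about `a`.**  Here it is derived from the two
Euler-top statements `CentreJet.EulerTopFirstIntegrals` (A1) / `CentreJet.NoHarmonicPolhodeInvariant` (A2) of the Theorems-side twin
`ThreadingFluxCentreJetDefs.lean` (ns-idea-15 «steady-centre-sieve» v1.3b; kernel proofs by ns-wall-eng-5 g5), taken as explicit
inputs — `harmonicBracketRigidity_of_eulerTop`; the input-free corollary lands in `ThreadingFluxReynoldsQuadrupoleHarmonicBracketRigidityByName.lean`
once A1/A2 are tree theorems.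

Proof.  Spectral frame of `M` (`LinearMap.IsSymmetric.eigenvectorBasis`).  (B) A REPEATED eigenvalue: `M y = μ(3⟪a,y⟫a − ⟪a,a⟫y)` for the
lone unit eigenvector `a` (`uniaxial_of_eigen`), so `det(y, ∇H, My) = 3μ⟪a,y⟫·det(y, ∇H, a)`; `ℝ[y]` is a domain and the bracket with a
constant vector is the polynomial `detP H ⟪a,·⟫` (`LoopLaw.loopBracket_evalE`), hence `det(y, ∇H, a) ≡ 0` (`axisym_of_uniaxial`) — third
alternative (`μ = 0` gives the first).  (C) THREE DISTINCT eigenvalues: transport to the eigenframe `(u, v, u × v)` with ns-wall-eng-5 g4's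
frame lemmas (`frameIso`, `gradient_comp_frameIso_symm`, `inner_cross_frameIso`): the rotated polynomial `q = H ∘ R⁻¹` satisfies
`Σᵢ eulerTopField α i · ∂ᵢ q = 0` (`W = y × Sy`, `S = diag α`), so A1 gives `q ∈ ℝ[|y|², ⟪y,Sy⟫]`, harmonicity + A2 give
`q = c₀ + c₁⟪y,Sy⟫`, homogeneity of degree `≥ 1` kills `c₀`, and rotating back `H = c₁·⟪x, Mx⟫` — second alternative
(`result_of_triaxial`).

HONEST FRAME: finite-dimensional algebra about two crux ideas' typed objects, information-grade; the rungs (`FarFieldQuadrupoleLaw`,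
`L2ShellRung`, the loop-law shape rigidity) are untouched; `PoloidalLiouville` (1222), `UnthreadedRigidity` (27585), 23843 and NS
regularity stay OPEN; W1/W2 movement 0.  [folklore]
-/

-- the summit and its single problem share the name (D-0017 nested layout)
set_option linter.dupNamespace false

noncomputable section


namespace Summit.NavierStokesRegularity.NavierStokesRegularity.Theorems.PoloidalLiouville.ReynoldsQuadrupole

open MvPolynomial
open scoped RealInnerProductSpace
open Literature.Analysis.FluidPDE
open Literature.Geometry.DiscreteGeometry (inner_fin3 norm_sq_fin3)
open Summit.NavierStokesRegularity.NavierStokesRegularity.Theorems.PoloidalLiouville.HorizonTower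

/-! ### Coordinate lemmas -/

/-- A linear form as a polynomial function: `evalE (Σ aᵢ Xᵢ) y = ⟪a, y⟫`. [folklore] -/
theorem evalE_linForm (a : E3) (y : E3) : Zonal.evalE (∑ i : Fin 3, C (a i) * X i) y = ⟪a, y⟫ := by
  rw [inner_fin3]; simp [Zonal.evalE, Fin.sum_univ_three]

/-- The gradient of the linear form `⟪a, ·⟫` (as a polynomial function) is `a`. [folklore] -/
theorem gradient_evalE_linForm (a : E3) (y : E3) : gradient (Zonal.evalE (∑ i : Fin 3, C (a i) * X i)) y = a := by
  ext j
  rw [Zonal.gradient_evalE_apply]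
  fin_cases j <;> simp [Zonal.evalE, Fin.sum_univ_three, pderiv_X]

/-- `⟪y, ∇H(y) × a⟫` for a polynomial `H` and a constant vector `a` is the polynomial `detP H ⟪a,·⟫`. [folklore] -/
theorem inner_cross_gradient_const (H : MvPolynomial (Fin 3) ℝ) (a y : E3) :
    ⟪y, cross (gradient (Zonal.evalE H) y) a⟫ = Zonal.evalE (Zonal.detP H (∑ i : Fin 3, C (a i) * X i)) y := by
  rw [← LoopLaw.loopBracket_evalE, gradient_evalE_linForm]

/-- `⟪y, g × y⟫ = 0`. [folklore] -/
theorem inner_cross_self_arg (y g : E3) : ⟪y, cross g y⟫ = 0 := by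
  obtain ⟨c0, c1, c2⟩ := cross_fin3 g y
  rw [inner_fin3, c0, c1, c2]; ring

/-- Linearity of `⟪y, g × ·⟫` on the uniaxial combination. [folklore] -/
theorem inner_cross_uniaxial (y g a : E3) (μ : ℝ) :
    ⟪y, cross g (μ • ((3 * ⟪a, y⟫) • a - ⟪a, a⟫ • y))⟫ = 3 * μ * ⟪a, y⟫ * ⟪y, cross g a⟫ := by
  obtain ⟨c0, c1, c2⟩ := cross_fin3 g (μ • ((3 * ⟪a, y⟫) • a - ⟪a, a⟫ • y))
  obtain ⟨d0, d1, d2⟩ := cross_fin3 g a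
  rw [inner_fin3, c0, c1, c2, inner_fin3 y (cross g a), d0, d1, d2]
  simp only [PiLp.smul_apply, PiLp.sub_apply, smul_eq_mul]
  ring

/-! ### The uniaxial case -/

/-- **Uniaxial case**: if `M y = μ(3⟪a,y⟫a − ⟪a,a⟫y)` with `μ ≠ 0`, `a ≠ 0`, and `⟪y, ∇H(y) × My⟫ ≡ 0` for a polynomial `H`, then
`⟪y, ∇H(y) × a⟫ ≡ 0` (the factor `3μ⟪a,y⟫` is cancelled in the domain `ℝ[y]`). -/
theorem axisym_of_uniaxial (H : MvPolynomial (Fin 3) ℝ) (M : E3 →L[ℝ] E3) (a : E3) (μ : ℝ) (hμ : μ ≠ 0) (ha : a ≠ 0)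
    (hMy : ∀ y : E3, M y = μ • ((3 * ⟪a, y⟫) • a - ⟪a, a⟫ • y))
    (hbr : ∀ y : E3, ⟪y, cross (gradient (Zonal.evalE H) y) (M y)⟫ = 0) :
    ∀ y : E3, ⟪y, cross (gradient (Zonal.evalE H) y) a⟫ = 0 := by
  set L : MvPolynomial (Fin 3) ℝ := ∑ i : Fin 3, C (a i) * X i with hL
  have hprod : C (3 * μ) * L * Zonal.detP H L = 0 := by
    refine Zonal.eq_zero_of_evalE_eq_zero fun y => ?_
    rw [Zonal.evalE_mul, Zonal.evalE_mul, Zonal.evalE_C, hL, evalE_linForm, ← inner_cross_gradient_const,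
      mul_assoc, ← mul_assoc (3 * μ), ← inner_cross_uniaxial, ← hMy]
    exact hbr y
  have hL0 : L ≠ 0 := by
    intro h
    have h1 : Zonal.evalE L a = ⟪a, a⟫ := by rw [hL, evalE_linForm]
    rw [h, Zonal.evalE_zero] at h1
    exact ha (inner_self_eq_zero.mp h1.symm)
  have hC : (C (3 * μ) : MvPolynomial (Fin 3) ℝ) ≠ 0 := by
    rw [Ne, C_eq_zero]; exact mul_ne_zero three_ne_zero hμ
  have hdet : Zonal.detP H L = 0 := by
    rcases mul_eq_zero.mp hprod with h | h
    · exact absurd h (mul_ne_zero hC hL0)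
    · exact h
  intro y
  rw [inner_cross_gradient_const, ← hL, hdet, Zonal.evalE_zero]

/-- Uniaxial form from an orthonormal eigen-triple with a repeated eigenvalue: `M e₀ = λe₀`, `M e₁ = λe₁`, `M e₂ = −2λ e₂` give
`M y = −λ(3⟪e₂,y⟫e₂ − ⟪e₂,e₂⟫y)`. [folklore] -/
theorem uniaxial_of_eigen (M : E3 →L[ℝ] E3) (e₀ e₁ e₂ : E3) (lam : ℝ)
    (hexp : ∀ y : E3, y = ⟪e₀, y⟫ • e₀ + ⟪e₁, y⟫ • e₁ + ⟪e₂, y⟫ • e₂) (he₂ : ⟪e₂, e₂⟫ = 1)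
    (h0 : M e₀ = lam • e₀) (h1 : M e₁ = lam • e₁) (h2 : M e₂ = (-2 * lam) • e₂) :
    ∀ y : E3, M y = (-lam) • ((3 * ⟪e₂, y⟫) • e₂ - ⟪e₂, e₂⟫ • y) := by
  intro y
  set c₀ := ⟪e₀, y⟫ with hc₀
  set c₁ := ⟪e₁, y⟫ with hc₁
  set c₂ := ⟪e₂, y⟫ with hc₂
  have hy : y = c₀ • e₀ + c₁ • e₁ + c₂ • e₂ := hexp y
  have hMy : M y = c₀ • M e₀ + c₁ • M e₁ + c₂ • M e₂ := by
    conv_lhs => rw [hy]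
    simp only [map_add, map_smul]
  rw [hMy, h0, h1, h2, he₂]
  clear_value c₀ c₁ c₂
  subst hy
  module

/-- The uniaxial case packaged: an orthonormal eigen-triple with a repeated eigenvalue yields the first or the third alternative. -/
theorem result_of_uniaxial (H : MvPolynomial (Fin 3) ℝ) (M : E3 →L[ℝ] E3) (e₀ e₁ e₂ : E3) (lam : ℝ)
    (hexp : ∀ y : E3, y = ⟪e₀, y⟫ • e₀ + ⟪e₁, y⟫ • e₁ + ⟪e₂, y⟫ • e₂) (he₂ : ⟪e₂, e₂⟫ = 1)
    (h0 : M e₀ = lam • e₀) (h1 : M e₁ = lam • e₁) (h2 : M e₂ = (-2 * lam) • e₂)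
    (hbr : ∀ y : E3, ⟪y, cross (gradient (Zonal.evalE H) y) (M y)⟫ = 0) :
    M = 0 ∨ ∃ (a : E3) (μ : ℝ), a ≠ 0 ∧ (∀ y : E3, M y = μ • ((3 * ⟪a, y⟫) • a - ⟪a, a⟫ • y)) ∧
      ∀ y : E3, ⟪y, cross (gradient (Zonal.evalE H) y) a⟫ = 0 := by
  have hMy := uniaxial_of_eigen M e₀ e₁ e₂ lam hexp he₂ h0 h1 h2
  by_cases hlam : lam = 0
  · left
    ext1 y
    simp [hMy y, hlam]
  · right
    have he : e₂ ≠ 0 := by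
      intro h; rw [h, inner_zero_left] at he₂; exact zero_ne_one he₂
    exact ⟨e₂, -lam, he, hMy, axisym_of_uniaxial H M e₂ (-lam) (neg_ne_zero.mpr hlam) he hMy hbr⟩

/-! ### The triaxial case: transport to the eigenframe and the Euler-top lemmas A1/A2 -/

/-- `⟪x, M x⟫` in an eigenframe. [folklore] -/
theorem inner_self_apply_of_frame (M : E3 →L[ℝ] E3) (f : Fin 3 → E3) (c : Fin 3 → ℝ)
    (hexp : ∀ y : E3, y = ⟪f 0, y⟫ • f 0 + ⟪f 1, y⟫ • f 1 + ⟪f 2, y⟫ • f 2) (hM : ∀ i, M (f i) = c i • f i) (x : E3) :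
    ⟪x, M x⟫ = c 0 * ⟪f 0, x⟫ ^ 2 + c 1 * ⟪f 1, x⟫ ^ 2 + c 2 * ⟪f 2, x⟫ ^ 2 := by
  have hMx : M x = ⟪f 0, x⟫ • M (f 0) + ⟪f 1, x⟫ • M (f 1) + ⟪f 2, x⟫ • M (f 2) := by
    conv_lhs => rw [hexp x]
    simp only [map_add, map_smul]
  rw [hMx, hM, hM, hM]
  simp only [inner_add_right, inner_smul_right, real_inner_comm (f _) x]
  ring

/-- **Triaxial case.**  `M` has an orthonormal eigen-triple `(u, v, u × v)` with pairwise distinct eigenvalues `α` summing to `0`; then a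
degree-`l ≥ 1` harmonic `H` with `⟪y, ∇H(y) × My⟫ ≡ 0` is `β·⟪y, My⟫` — by transport to the eigenframe (eng-5 g4's frame lemmas), the
Euler-top first-integral lemma A1 and the harmonic-polhode lemma A2 (eng-5 g5). -/
theorem result_of_triaxial (hA1 : CentreJet.EulerTopFirstIntegrals) (hA2 : CentreJet.NoHarmonicPolhodeInvariant)
    (H : MvPolynomial (Fin 3) ℝ) (M : E3 →L[ℝ] E3) {l : ℕ} (hl : 1 ≤ l) (hH : H.IsHomogeneous l)
    (hharm : ∀ y : E3, Laplacian.laplacian (Zonal.evalE H) y = 0)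
    (hbr : ∀ y : E3, ⟪y, cross (gradient (Zonal.evalE H) y) (M y)⟫ = 0)
    {u v : E3} (hu : ‖u‖ = 1) (hv : ‖v‖ = 1) (huv : ⟪u, v⟫ = 0) (α : Fin 3 → ℝ)
    (hMf : ∀ i, M (Zonal.frameVec u v i) = α i • Zonal.frameVec u v i) (hαinj : Function.Injective α)
    (hαsum : ∑ i, α i = 0) :
    ∃ β : ℝ, ∀ x : E3, Zonal.evalE H x = β * ⟪x, M x⟫ := by
  classical
  set R := Zonal.frameIso hu hv huv with hR
  -- the rotated polynomial
  set K : E3 → ℝ := fun y => Zonal.evalE H (R.symm y) with hK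
  set lin : Fin 3 → MvPolynomial (Fin 3) ℝ := fun j => ∑ i : Fin 3, C ((Zonal.frameVec u v i) j) * X i with hlin
  set q : MvPolynomial (Fin 3) ℝ := bind₁ lin H with hq
  have hqh : q.IsHomogeneous l := by
    have h1 : ∀ j, (lin j).IsHomogeneous 1 := fun j =>
      IsHomogeneous.sum _ _ _ fun i _ => (isHomogeneous_X ℝ i).C_mul _
    have := hH.aeval lin h1
    rw [one_mul] at this
    rw [hq, ← aeval_eq_bind₁]; exact this
  have hKq : ∀ y, K y = Zonal.evalE q y := by
    intro y
    rw [hK, hq]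
    simp only
    rw [Zonal.evalE, Zonal.evalE]
    change _ = eval₂Hom (RingHom.id ℝ) (fun i => y i) (bind₁ lin H)
    rw [eval₂Hom_bind₁]
    change eval (fun i => (R.symm y) i) H = eval (fun j => eval (fun i => y i) (lin j)) H
    have harg : (fun i => (R.symm y) i) = fun j => eval (fun i => y i) (lin j) := by
      funext j
      rw [hR, Zonal.frameIso_symm_apply, hlin]
      simp [Fin.sum_univ_three]
      ring
    rw [harg]
  have hKfun : K = Zonal.evalE q := funext hKq
  -- harmonicity transports
  have hlapq : Zonal.lapP q = 0 := by
    refine Zonal.eq_zero_of_evalE_eq_zero fun y => ?_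
    rw [← Zonal.laplacian_evalE, ← hKfun]
    exact Zonal.harmonic_comp_frameIso_symm hu hv huv hharm y
  -- the transported tensor is diagonal: `R M R⁻¹ y = (αᵢ yᵢ)ᵢ`
  have hn1 : ⟪cross u v, cross u v⟫ = 1 := by
    rw [real_inner_self_eq_norm_sq, Zonal.norm_cross_sq, hu, hv, huv]; norm_num
  have huu : ⟪u, u⟫ = 1 := by rw [real_inner_self_eq_norm_sq, hu]; norm_num
  have hvv : ⟪v, v⟫ = 1 := by rw [real_inner_self_eq_norm_sq, hv]; norm_num
  have hvu : ⟪v, u⟫ = 0 := by rw [real_inner_comm, huv]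
  have hun : ⟪u, cross u v⟫ = 0 := by rw [real_inner_comm]; exact Zonal.inner_cross_self_left u v
  have hvn : ⟪v, cross u v⟫ = 0 := by rw [real_inner_comm]; exact Zonal.inner_cross_self_right u v
  have hnu : ⟪cross u v, u⟫ = 0 := Zonal.inner_cross_self_left u v
  have hnv : ⟪cross u v, v⟫ = 0 := Zonal.inner_cross_self_right u v
  have hS : ∀ (y : E3) (i : Fin 3), R (M (R.symm y)) i = α i * y i := by
    intro y i
    have h0 := hMf 0; have h1 := hMf 1; have h2 := hMf 2
    simp only [Zonal.frameVec_zero, Zonal.frameVec_one, Zonal.frameVec_two] at h0 h1 h2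
    rw [hR, Zonal.frameIso_symm_apply]
    simp only [map_add, map_smul, h0, h1, h2, PiLp.add_apply, PiLp.smul_apply, smul_eq_mul, Zonal.frameIso_apply]
    have hn1' : ‖cross u v‖ ^ 2 = 1 := by rw [Zonal.norm_cross_sq, hu, hv, huv]; norm_num
    fin_cases i <;> simp [hu, hv, hvu, huv, hun, hvn, hnu, hnv, hn1'] <;> ring
  -- the transported bracket
  have hbrK : ∀ y : E3, ⟪y, cross (gradient K y) (R (M (R.symm y)))⟫ = 0 := by
    intro y
    have key := Zonal.inner_cross_frameIso hu hv huv (R.symm y) (gradient (Zonal.evalE H) (R.symm y)) (M (R.symm y))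
    rw [← hR, LinearIsometryEquiv.apply_symm_apply, hbr, mul_zero] at key
    rw [hK, Zonal.gradient_comp_frameIso_symm, ← hR]
    exact key
  -- the Euler-top identity for `q`
  have hW : ∑ i : Fin 3, CentreJet.eulerTopField α i * pderiv i q = 0 := by
    refine Zonal.eq_zero_of_evalE_eq_zero fun y => ?_
    have hg : ∀ i, Zonal.evalE (pderiv i q) y = gradient K y i := by
      intro i; rw [hKfun, Zonal.gradient_evalE_apply]
    have h0 := hbrK y
    obtain ⟨c0, c1, c2⟩ := cross_fin3 (gradient K y) (R (M (R.symm y)))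
    rw [inner_fin3, c0, c1, c2, hS y 0, hS y 1, hS y 2] at h0
    rw [Fin.sum_univ_three]
    simp only [Zonal.evalE_add, Zonal.evalE_mul, hg, CentreJet.eulerTopField, Matrix.cons_val_zero, Matrix.cons_val_one,
      Matrix.head_cons, Matrix.cons_val_two, Matrix.tail_cons, Zonal.evalE_C, Zonal.evalE_X]
    linear_combination (-1 : ℝ) * h0
  -- A1 and A2
  obtain ⟨F, hF⟩ := hA1 α hαinj q hW
  have hlapF : ∑ i : Fin 3, pderiv i (pderiv i (aeval ![CentreJet.rhoPoly, CentreJet.strainPoly α] F)) = 0 := by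
    rw [← hF, Fin.sum_univ_three]
    exact hlapq
  obtain ⟨c₀, c₁, hFc⟩ := hA2 α hαinj hαsum F hlapF
  have hqc : q = C c₀ + C c₁ * CentreJet.strainPoly α := by
    rw [hF, hFc]
    simp [MvPolynomial.algebraMap_eq]
  have hc₀ : c₀ = 0 := by
    have h := hqh.coeff_eq_zero (d := 0) (by simp; omega)
    rw [hqc, coeff_add, coeff_C, if_pos rfl, coeff_C_mul] at h
    have hs : coeff 0 (CentreJet.strainPoly α) = 0 := by
      simp [CentreJet.strainPoly, coeff_C_mul, Fin.sum_univ_three, coeff_X_pow]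
    rw [hs, mul_zero, add_zero] at h
    exact h
  -- conclusion
  have hexpf : ∀ y : E3, y = ⟪Zonal.frameVec u v 0, y⟫ • Zonal.frameVec u v 0 + ⟪Zonal.frameVec u v 1, y⟫ • Zonal.frameVec u v 1
      + ⟪Zonal.frameVec u v 2, y⟫ • Zonal.frameVec u v 2 := by
    intro y
    conv_lhs => rw [← (Zonal.frameBasis hu hv huv).sum_repr' y]
    rw [Fin.sum_univ_three, Zonal.frameBasis_apply, Zonal.frameBasis_apply, Zonal.frameBasis_apply]
  refine ⟨c₁, fun x => ?_⟩
  have h1 : Zonal.evalE H x = K (R x) := by rw [hK]; simp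
  rw [h1, hKq, hqc, hc₀, inner_self_apply_of_frame M (Zonal.frameVec u v) α hexpf hMf x, map_zero, zero_add,
    Zonal.evalE_mul, Zonal.evalE_C]
  have hev : Zonal.evalE (CentreJet.strainPoly α) (R x) = α 0 * (R x) 0 ^ 2 + α 1 * (R x) 1 ^ 2 + α 2 * (R x) 2 ^ 2 := by
    simp [CentreJet.strainPoly, Zonal.evalE, Fin.sum_univ_three]
  rw [hev, hR, Zonal.frameIso_apply, Zonal.frameIso_apply, Zonal.frameIso_apply]

/-! ### Assembly -/

/-- ★ **HARMONIC BRACKET RIGIDITY** (body of ReynoldsQuadrupoleSketch `HarmonicBracketRigidity`, VERBATIM with the sketch-local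
`IsShapeTensor` ↦ the character-identical `HorizonTower.IsShapeTensor`), from the Euler-top lemmas A1/A2: a degree-`l ≥ 1` harmonic
polynomial `H` with `det(y, ∇H(y), My) ≡ 0` for a traceless symmetric `M` satisfies `M = 0`, or `H = β·⟪y, My⟫`, or `M` is uniaxial
with axis `a` and `H` is axisymmetric about `a`. -/
theorem harmonicBracketRigidity_of_eulerTop (hA1 : CentreJet.EulerTopFirstIntegrals) (hA2 : CentreJet.NoHarmonicPolhodeInvariant) :
    ∀ (l : ℕ) (H : MvPolynomial (Fin 3) ℝ) (M : E3 →L[ℝ] E3), 1 ≤ l → H.IsHomogeneous l →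
    (∀ y : E3, Laplacian.laplacian (fun z : E3 => MvPolynomial.eval (fun i => z i) H) y = 0) →
    IsShapeTensor M →
    (∀ y : E3, inner ℝ y (Literature.Analysis.FluidPDE.cross
        (gradient (fun z : E3 => MvPolynomial.eval (fun i => z i) H) y) (M y)) = 0) →
    M = 0 ∨ (∃ β : ℝ, ∀ y : E3, MvPolynomial.eval (fun i => y i) H = β * inner ℝ y (M y)) ∨
      ∃ (a : E3) (μ : ℝ), a ≠ 0 ∧ (∀ y : E3, M y = μ • ((3 * inner ℝ a y) • a - (inner ℝ a a) • y)) ∧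
        ∀ y : E3, inner ℝ y (Literature.Analysis.FluidPDE.cross
          (gradient (fun z : E3 => MvPolynomial.eval (fun i => z i) H) y) a) = 0 := by
  intro l H M hl hH hharm hM hbr
  classical
  have eH : (fun z : E3 => MvPolynomial.eval (fun i => z i) H) = Zonal.evalE H := rfl
  rw [eH] at hharm hbr
  rw [eH]
  obtain ⟨hMs, hMtr⟩ := hM
  -- spectral frame of `M`
  set T : E3 →ₗ[ℝ] E3 := (M : E3 →ₗ[ℝ] E3) with hT
  have hTs : T.IsSymmetric := fun x y => hMs x y
  have hn : Module.finrank ℝ E3 = 3 := finrank_euclideanSpace_fin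
  set b : OrthonormalBasis (Fin 3) ℝ E3 := hTs.eigenvectorBasis hn with hb
  set α : Fin 3 → ℝ := hTs.eigenvalues hn with hα
  have hMb : ∀ i : Fin 3, M (b i) = α i • b i := fun i => by
    have h : T (b i) = (RCLike.ofReal (α i) : ℝ) • b i := hTs.apply_eigenvectorBasis hn i
    simpa [hT] using h
  have hαsum : α 0 + α 1 + α 2 = 0 := by
    have h := hTs.trace_eq_sum_eigenvalues hn
    rw [Fin.sum_univ_three] at h
    have h' : LinearMap.trace ℝ E3 T = 0 := hMtr
    rw [h'] at h
    simpa [hα] using h.symm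
  have hbn : ∀ i, ⟪b i, b i⟫ = 1 := fun i => by
    rw [real_inner_self_eq_norm_sq, b.orthonormal.1 i]; norm_num
  have hexp : ∀ y : E3, y = ⟪b 0, y⟫ • b 0 + ⟪b 1, y⟫ • b 1 + ⟪b 2, y⟫ • b 2 := fun y => by
    conv_lhs => rw [← b.sum_repr' y]
    rw [Fin.sum_univ_three]
  -- a repeated eigenvalue: uniaxial (or zero) `M`
  by_cases h01 : α 0 = α 1
  · have h2 : M (b 2) = (-2 * α 0) • b 2 := by rw [hMb]; congr 1; linarith
    rcases result_of_uniaxial H M (b 0) (b 1) (b 2) (α 0) hexp (hbn 2) (hMb 0) (by rw [hMb, h01]) h2 hbr with h | h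
    · exact Or.inl h
    · exact Or.inr (Or.inr h)
  by_cases h02 : α 0 = α 2
  · have h1 : M (b 1) = (-2 * α 0) • b 1 := by rw [hMb]; congr 1; linarith
    rcases result_of_uniaxial H M (b 0) (b 2) (b 1) (α 0) (fun y => (hexp y).trans (by abel)) (hbn 1) (hMb 0)
      (by rw [hMb, h02]) h1 hbr with h | h
    · exact Or.inl h
    · exact Or.inr (Or.inr h)
  by_cases h12 : α 1 = α 2
  · have h0 : M (b 0) = (-2 * α 1) • b 0 := by rw [hMb]; congr 1; linarith
    rcases result_of_uniaxial H M (b 1) (b 2) (b 0) (α 1) (fun y => (hexp y).trans (by abel)) (hbn 0) (hMb 1)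
      (by rw [hMb, h12]) h0 hbr with h | h
    · exact Or.inl h
    · exact Or.inr (Or.inr h)
  -- three distinct eigenvalues: the triaxial case in the frame `(b₀, b₁, b₀ × b₁)`
  have hu : ‖b 0‖ = 1 := b.orthonormal.1 0
  have hv : ‖b 1‖ = 1 := b.orthonormal.1 1
  have huv : ⟪b 0, b 1⟫ = 0 := b.orthonormal.2 (by decide)
  have hn' : cross (b 0) (b 1) = ⟪b 2, cross (b 0) (b 1)⟫ • b 2 := by
    have e := hexp (cross (b 0) (b 1))
    have e0 : ⟪b 0, cross (b 0) (b 1)⟫ = 0 := by rw [real_inner_comm]; exact Zonal.inner_cross_self_left _ _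
    have e1 : ⟪b 1, cross (b 0) (b 1)⟫ = 0 := by rw [real_inner_comm]; exact Zonal.inner_cross_self_right _ _
    rw [e0, e1, zero_smul, zero_smul, zero_add, zero_add] at e
    exact e
  have hMn : M (cross (b 0) (b 1)) = α 2 • cross (b 0) (b 1) := by
    calc M (cross (b 0) (b 1)) = M (⟪b 2, cross (b 0) (b 1)⟫ • b 2) := by rw [← hn']
      _ = ⟪b 2, cross (b 0) (b 1)⟫ • (α 2 • b 2) := by rw [map_smul, hMb 2]
      _ = α 2 • (⟪b 2, cross (b 0) (b 1)⟫ • b 2) := smul_comm _ _ _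
      _ = α 2 • cross (b 0) (b 1) := by rw [← hn']
  have hMf : ∀ i, M (Zonal.frameVec (b 0) (b 1) i) = α i • Zonal.frameVec (b 0) (b 1) i := by
    intro i
    fin_cases i
    · exact hMb 0
    · exact hMb 1
    · exact hMn
  have hαinj : Function.Injective α := by
    intro i j hij
    fin_cases i <;> fin_cases j
    all_goals first
      | rfl
      | exact absurd hij h01 | exact absurd hij.symm h01
      | exact absurd hij h02 | exact absurd hij.symm h02
      | exact absurd hij h12 | exact absurd hij.symm h12
  have hαsum' : ∑ i, α i = 0 := by rw [Fin.sum_univ_three]; exact hαsum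
  obtain ⟨β, hβ⟩ := result_of_triaxial hA1 hA2 H M hl hH hharm hbr hu hv huv α hMf hαinj hαsum'
  exact Or.inr (Or.inl ⟨β, fun y => hβ y⟩)

end Summit.NavierStokesRegularity.NavierStokesRegularity.Theorems.PoloidalLiouville.ReynoldsQuadrupole

end
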